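import Literature.RingTheory.KrullDimension.AffineDimension
import Mathlib.RingTheory.RegularLocalRing.Defs
import Mathlib.RingTheory.Nakayama
import Mathlib.RingTheory.LocalRing.ResidueField.Basic
import HarnessLib

/-!
# Invariants of a tame cyclic group acting on a regular local ring by a pseudo-reflection

Topic: `Literature/AlgebraicGeometry/Resolution`. PROOF side of `CossartPiltant2019ReductionP`
(`ArithmeticalThreefoldsLocal.lean`), first brick of its one remaining input (C4) — descent of
local uniformization below the ramification field ([CoP1] Prop. 9.3 = HAL Prop. 9.5), whose
Kummer-descent step is [CoP1] Lemma 9.4: for a cyclic Galois extension of prime degree `l ≠ p`,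
totally ramified along the valuation, a `G`-stable local uniformization `S₁` upstairs on which a
generator acts by `z₁ ↦ ζ_l^t z₁`, `z₂ ↦ z₂`, `z₃ ↦ z₃` has a regular ring of invariants: "Therefore
`Ŝ₁^G = (Ŝ₁)^G = κ(S₁)[[z₁^l, z₂, z₃]]` is a regular local ring. Thus `S₁^G` is a local
uniformization of `V/k`" (HAL p. 29). This file proves the underlying statement of commutative
algebra, without completions:

* `isRegularLocalRing_of_fixed_pseudoReflection` — PROVED: for a finite injective extension of
  local rings `A → B`, `A` Noetherian, `B` regular of dimension `d + 1`, an `A`-automorphism `σ`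
  of `B` of order dividing `ℓ` with fixed ring `A` and `κ(A) = κ(B)`, `ℓ ∈ Aˣ`, `ζ ∈ A` with
  `ζ^ℓ = 1` and `ζ^k − 1 ∈ Aˣ` for `0 < k < ℓ`, and a regular system of parameters
  `(z₀, z₁, …, z_d)` of `B` with `σ z₀ = ζ z₀`, `zⱼ ∈ A` (`j ≥ 1`): `𝔪_A = (z₀^ℓ, z₁, …, z_d)` and `A`
  is regular. (Twisted Reynolds operators `P_k = ∑ᵢ ζ^{−ki} σⁱ`, eigenmodules `B_k = P_k(B)`,
  `B_k = z₀ B_{k−1}` by Nakayama, `𝔪_A = P_0(𝔪_B)`.)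

Everything is PROVED; no named facts are introduced.

## Sources

* V. Cossart, O. Piltant, J. Algebra 320 (2008) 1051–1082, proof of Lemma 9.4 (HAL
  hal-00139124, pp. 28–29). [CossartPiltant2008]
-/

noncomputable section

open IsLocalRing

namespace Literature.AlgebraicGeometry.Resolution

universe u

/-! ## Invariants of a tame cyclic group acting by a pseudo-reflection on a regular local ring -/

section Invariants

variable {A B : Type u} [CommRing A] [CommRing B] [Algebra A B]

/-- **The ring of invariants of a tame cyclic group acting on a regular local ring by a
pseudo-reflection is regular** ([CoP1] proof of Lemma 9.4: "`Ŝ₁^G = κ(S₁)[[z₁^l, z₂, z₃]]` is a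
regular local ring. Thus `S₁^G` is a local uniformization", HAL p. 29; proved here algebraically,
without completion). Data: a finite injective extension `A → B` of local rings with `A`
Noetherian and `B` regular of dimension `d + 1`, an `A`-automorphism `σ` of `B` with `σ^ℓ = 1`
whose fixed ring is `A`, the same residue field (`κ(A) → κ(B)` onto), `ℓ` a unit of `A`, `ζ ∈ A`
with `ζ^ℓ = 1` and `ζ^k − 1` a unit for `0 < k < ℓ`, and a regular system of parameters
`(z₀, z₁, …, z_d)` of `B` with `σ z₀ = ζ z₀` and `z₁, …, z_d ∈ A`. Then `𝔪_A = (z₀^ℓ, z₁, …, z_d)`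
and `A` is a regular local ring. Proof: with the twisted Reynolds operators
`P_k = ∑ ζ^{−ki} σⁱ` and the eigenmodules `B_k = P_k(B)` (`B_0 = A`): `B_k ⊆ 𝔪_B` for `ℓ ∤ k`
(residue fields agree), `B_k ⊆ z₀ B_{k−1} + 𝔪_A B_k`, so `B_k = z₀ B_{k−1} = z₀^k A` by Nakayama,
and `𝔪_A = P_0(𝔪_B) = z₀ B_{ℓ−1} + ∑ zⱼ A = (z₀^ℓ, zⱼ)`; `dim A = dim B`.
[cite: CossartPiltant2008, proof of Lemma 9.4 (HAL p. 29)] -/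
theorem isRegularLocalRing_of_fixed_pseudoReflection [IsLocalRing A] [IsNoetherianRing A]
    [IsRegularLocalRing B] [Module.Finite A B] (hinj : Function.Injective (algebraMap A B))
    (σ : B ≃ₐ[A] B) {ℓ : ℕ} (hℓ0 : ℓ ≠ 0) (hσℓ : σ ^ ℓ = 1) (hℓu : IsUnit ((ℓ : A)))
    (ζ : A) (hζℓ : ζ ^ ℓ = 1) (hζu : ∀ k : ℕ, 0 < k → k < ℓ → IsUnit (ζ ^ k - 1))
    (hfix : ∀ b : B, σ b = b → b ∈ Set.range (algebraMap A B))
    (hres : ∀ b : B, ∃ a : A, b - algebraMap A B a ∈ maximalIdeal B)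
    {d : ℕ} (z₀ : B) (z : Fin d → A)
    (hspan : Ideal.span (insert z₀ (Set.range fun j => algebraMap A B (z j))) = maximalIdeal B)
    (hdim : ringKrullDim B = (d + 1 : ℕ))
    (hz₀ : σ z₀ = algebraMap A B ζ * z₀) :
    IsRegularLocalRing A ∧ ∃ w₀ : A, algebraMap A B w₀ = z₀ ^ ℓ ∧
      Ideal.span (insert w₀ (Set.range z)) = maximalIdeal A := by
  classical
  -- notation and basic identities
  set φ := algebraMap A B with hφ
  haveI : Algebra.IsIntegral A B := Algebra.IsIntegral.of_finite A B
  have hℓpos : 0 < ℓ := Nat.pos_of_ne_zero hℓ0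
  set ζ' : A := ζ ^ (ℓ - 1) with hζ'def
  have hζζ' : ζ * ζ' = 1 := by
    rw [hζ'def, ← pow_succ', Nat.sub_add_cancel hℓpos, hζℓ]
  have hζ'ζ : ζ' * ζ = 1 := by rw [mul_comm, hζζ']
  have hζ'ℓ : ζ' ^ ℓ = 1 := by rw [hζ'def, ← pow_mul, mul_comm, pow_mul, hζℓ, one_pow]
  have hζ'pred : ζ' ^ (ℓ - 1) = ζ := by
    -- both are inverses of `ζ'`
    have h1 : ζ' ^ (ℓ - 1) * ζ' = 1 := by rw [← pow_succ, Nat.sub_add_cancel hℓpos, hζ'ℓ]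
    calc ζ' ^ (ℓ - 1) = ζ' ^ (ℓ - 1) * (ζ' * ζ) := by rw [hζ'ζ, mul_one]
      _ = (ζ' ^ (ℓ - 1) * ζ') * ζ := by ring
      _ = ζ := by rw [h1, one_mul]
  obtain ⟨ℓu, hℓu'⟩ := hℓu
  have hσA : ∀ (i : ℕ) (a : A), (σ ^ i) (φ a) = φ a := fun i a => AlgEquiv.commutes _ a
  have hσz₀ : ∀ i : ℕ, (σ ^ i) z₀ = φ (ζ ^ i) * z₀ := by
    intro i
    induction i with
    | zero => simp
    | succ i ih =>
      rw [pow_succ', AlgEquiv.mul_apply, ih, map_mul, AlgEquiv.commutes, hz₀, ← mul_assoc, ← map_mul,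
        ← pow_succ]
  have hσℓb : ∀ b : B, (σ ^ ℓ) b = b := fun b => by rw [hσℓ]; rfl
  -- the maximal ideals correspond
  have hcomap : (maximalIdeal B).comap φ = maximalIdeal A :=
    IsLocalRing.eq_maximalIdeal (Ideal.isMaximal_comap_of_isIntegral_of_isMaximal (maximalIdeal B))
  have hmemA : ∀ a : A, a ∈ maximalIdeal A ↔ φ a ∈ maximalIdeal B := fun a => by
    rw [← hcomap, Ideal.mem_comap]
  have hσm : ∀ (i : ℕ) (b : B), b ∈ maximalIdeal B → (σ ^ i) b ∈ maximalIdeal B := by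
    intro i b hb
    rw [IsLocalRing.mem_maximalIdeal, mem_nonunits_iff] at hb ⊢
    intro hu
    apply hb
    have := hu.map (σ ^ i).symm
    rwa [AlgEquiv.symm_apply_apply] at this
  have hz₀m : z₀ ∈ maximalIdeal B := hspan ▸ Ideal.subset_span (Set.mem_insert _ _)
  have hzm : ∀ j, z j ∈ maximalIdeal A := fun j =>
    (hmemA _).mpr (hspan ▸ Ideal.subset_span (Set.mem_insert_of_mem _ ⟨j, rfl⟩))
  have hℓB : IsUnit (φ (ℓ : A)) := (hℓu' ▸ ℓu.isUnit).map φ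
  have hℓdiv : ∀ b : B, (ℓ : B) * b ∈ maximalIdeal B → b ∈ maximalIdeal B := by
    intro b hb
    obtain ⟨v, hv⟩ := hℓB
    have hvB : (v : B) = (ℓ : B) := by rw [hv, map_natCast]
    have : b = (↑v⁻¹ : B) * ((ℓ : B) * b) := by
      rw [← hvB, ← mul_assoc, Units.inv_mul, one_mul]
    rw [this]
    exact Ideal.mul_mem_left _ _ hb
  /- the twisted Reynolds operators -/
  let P : ℕ → B → B := fun k b => ∑ i ∈ Finset.range ℓ, φ (ζ' ^ (k * i)) * (σ ^ i) b
  have hPdef : ∀ k b, P k b = ∑ i ∈ Finset.range ℓ, φ (ζ' ^ (k * i)) * (σ ^ i) b := fun _ _ => rfl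
  have hPadd : ∀ k b c, P k (b + c) = P k b + P k c := by
    intro k b c
    simp only [hPdef, map_add, mul_add, Finset.sum_add_distrib]
  have hPA : ∀ k (a : A) b, P k (φ a * b) = φ a * P k b := by
    intro k a b
    simp only [hPdef, Finset.mul_sum, map_mul, hσA]
    exact Finset.sum_congr rfl fun i _ => by ring
  let Pl : ℕ → B →ₗ[A] B := fun k =>
    { toFun := P k
      map_add' := hPadd k
      map_smul' := fun a b => by
        rw [Algebra.smul_def, hPA, RingHom.id_apply, Algebra.smul_def] }
  have hPl : ∀ k b, Pl k b = P k b := fun _ _ => rfl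
  -- (L2) shifting against `z₀`
  have hPz : ∀ k b, 0 < k → P k (z₀ * b) = z₀ * P (k - 1) b := by
    intro k b hk
    rw [hPdef, hPdef, Finset.mul_sum]
    refine Finset.sum_congr rfl fun i _ => ?_
    have h2 : k * i = (k - 1) * i + i := by
      obtain ⟨k', rfl⟩ : ∃ k', k = k' + 1 := ⟨k - 1, by omega⟩
      rw [Nat.add_sub_cancel, Nat.add_mul, one_mul]
    have h1 : ζ' ^ (k * i) * ζ ^ i = ζ' ^ ((k - 1) * i) := by
      rw [h2, pow_add, mul_assoc, ← mul_pow, hζ'ζ, one_pow, mul_one]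
    rw [map_mul (σ ^ i) z₀ b, hσz₀ i, ← h1, map_mul]
    ring
  have hPz' : ∀ b, P 0 (z₀ * b) = z₀ * P (ℓ - 1) b := by
    intro b
    rw [hPdef, hPdef, Finset.mul_sum]
    refine Finset.sum_congr rfl fun i _ => ?_
    have h1 : ζ' ^ (0 * i) * ζ ^ i = ζ' ^ ((ℓ - 1) * i) := by
      rw [zero_mul, pow_zero, one_mul, pow_mul, hζ'pred]
    rw [map_mul (σ ^ i) z₀ b, hσz₀ i, ← h1, map_mul]
    ring
  -- (L3) `σ ∘ P_k = ζ^k P_k`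
  have hσP : ∀ k b, σ (P k b) = φ (ζ ^ k) * P k b := by
    intro k b
    rw [hPdef, map_sum, Finset.mul_sum]
    -- `f i := φ(ζ^k ζ'^{ki}) σⁱ b`; LHS = ∑_{i<ℓ} f (i+1), RHS = ∑_{i<ℓ} f i, and `f ℓ = f 0`
    let f : ℕ → B := fun i => φ (ζ ^ k * ζ' ^ (k * i)) * (σ ^ i) b
    have hf : ∀ i, σ (φ (ζ' ^ (k * i)) * (σ ^ i) b) = f (i + 1) := by
      intro i
      rw [map_mul, AlgEquiv.commutes, show σ ((σ ^ i) b) = (σ ^ (i + 1)) b by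
        rw [pow_succ', AlgEquiv.mul_apply]]
      change _ = φ (ζ ^ k * ζ' ^ (k * (i + 1))) * (σ ^ (i + 1)) b
      congr 1
      rw [mul_add, mul_one, pow_add, ← mul_assoc, mul_comm (ζ ^ k), mul_assoc, ← mul_pow, hζζ',
        one_pow, mul_one]
    have hg : ∀ i, φ (ζ ^ k) * (φ (ζ' ^ (k * i)) * (σ ^ i) b) = f i := by
      intro i
      change _ = φ (ζ ^ k * ζ' ^ (k * i)) * (σ ^ i) b
      rw [map_mul, mul_assoc]
    simp only [hf, hg]
    have hfℓ : f ℓ = f 0 := by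
      change φ (ζ ^ k * ζ' ^ (k * ℓ)) * (σ ^ ℓ) b = φ (ζ ^ k * ζ' ^ (k * 0)) * (σ ^ 0) b
      rw [mul_comm k ℓ, pow_mul, hζ'ℓ, one_pow, mul_zero, pow_zero, hσℓb, pow_zero, AlgEquiv.one_apply]
    obtain ⟨m, hm⟩ : ∃ m, ℓ = m + 1 := ⟨ℓ - 1, by omega⟩
    rw [hm, Finset.sum_range_succ' f, Finset.sum_range_succ (fun x => f (x + 1)), ← hm, hfℓ]
  have hσiP : ∀ (i k : ℕ) b, (σ ^ i) (P k b) = φ (ζ ^ (k * i)) * P k b := by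
    intro i k b
    induction i with
    | zero => simp
    | succ i ih =>
      rw [pow_succ', AlgEquiv.mul_apply, ih, map_mul, AlgEquiv.commutes, hσP, ← mul_assoc, ← map_mul,
        ← pow_add, show k * i + k = k * (i + 1) by ring]
  -- (L4) `P_k ∘ P_k = ℓ P_k`
  have hPP : ∀ k b, P k (P k b) = (ℓ : B) * P k b := by
    intro k b
    conv_lhs => rw [hPdef]
    have h1 : ∀ i ∈ Finset.range ℓ, φ (ζ' ^ (k * i)) * (σ ^ i) (P k b) = P k b := by
      intro i _
      rw [hσiP, ← mul_assoc, ← map_mul, ← mul_pow, hζ'ζ, one_pow, map_one, one_mul]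
    rw [Finset.sum_congr rfl h1, Finset.sum_const, Finset.card_range, nsmul_eq_mul]
  -- (L5) `P_k` on `A`: multiplication by the character sum, which vanishes for `0 < k < ℓ`
  have hPφ : ∀ k (a : A), P k (φ a) = φ ((∑ i ∈ Finset.range ℓ, ζ' ^ (k * i)) * a) := by
    intro k a
    rw [hPdef, map_mul, map_sum, Finset.sum_mul]
    exact Finset.sum_congr rfl fun i _ => by rw [hσA]
  have hchar : ∀ k, 0 < k → k < ℓ → (∑ i ∈ Finset.range ℓ, ζ' ^ (k * i)) = 0 := by
    intro k hk hkℓ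
    have h1 : (∑ i ∈ Finset.range ℓ, (ζ' ^ k) ^ i) * (ζ' ^ k - 1) = 0 := by
      rw [geom_sum_mul, ← pow_mul, mul_comm, pow_mul, hζ'ℓ, one_pow, sub_self]
    -- `ζ'^k − 1 = −ζ'^k (ζ^k − 1)` is a unit
    have hu : IsUnit (ζ' ^ k - 1) := by
      have h2 : ζ' ^ k - 1 = -(ζ' ^ k * (ζ ^ k - 1)) := by
        rw [mul_sub, mul_one, ← mul_pow, hζ'ζ, one_pow]; ring
      rw [h2]
      exact ((IsUnit.of_mul_eq_one ζ hζ'ζ).pow k |>.mul (hζu k hk hkℓ)).neg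
    have h3 : (∑ i ∈ Finset.range ℓ, (ζ' ^ k) ^ i) = 0 :=
      (hu.mul_left_eq_zero).mp h1
    rw [← h3]
    exact Finset.sum_congr rfl fun i _ => by rw [pow_mul]
  have hchar0 : (∑ i ∈ Finset.range ℓ, ζ' ^ (0 * i)) = ℓ := by
    simp
  -- (L6) `P_k(𝔪_B) ⊆ 𝔪_B`
  have hPm : ∀ k b, b ∈ maximalIdeal B → P k b ∈ maximalIdeal B := by
    intro k b hb
    rw [hPdef]
    exact Ideal.sum_mem _ fun i _ => Ideal.mul_mem_left _ _ (hσm i b hb)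
  /- the eigenmodules `B_k = P_k(B)` -/
  let Bk : ℕ → Submodule A B := fun k => LinearMap.range (Pl k)
  have hBkfg : ∀ k, (Bk k).FG := fun k => by
    change (LinearMap.range (Pl k)).FG
    rw [LinearMap.range_eq_map]
    exact Submodule.FG.map _ Module.Finite.fg_top
  have hmemBk : ∀ k b, b ∈ Bk k ↔ ∃ c, P k c = b := fun k b => LinearMap.mem_range
  -- (S1) `B_k ⊆ 𝔪_B` for `0 < k < ℓ`
  have hBkm : ∀ k, 0 < k → k < ℓ → ∀ b ∈ Bk k, b ∈ maximalIdeal B := by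
    intro k hk hkℓ b hb
    obtain ⟨c, rfl⟩ := (hmemBk k b).mp hb
    obtain ⟨a, ha⟩ := hres (P k c)
    have h1 : P k (P k c - φ a) ∈ maximalIdeal B := hPm k _ ha
    rw [sub_eq_add_neg, hPadd, hPP, show -φ a = φ (-a) from (map_neg φ a).symm, hPφ, hchar k hk hkℓ,
      zero_mul, map_zero, add_zero] at h1
    exact hℓdiv _ h1
  -- multiplication by `z₀` as an `A`-linear map
  let μ : B →ₗ[A] B := LinearMap.mulLeft A z₀
  have hμ : ∀ b, μ b = z₀ * b := fun b => rfl
  -- (S2) `B_k ⊆ z₀ B_{k−1}` for `0 < k < ℓ` (Nakayama)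
  have hstep : ∀ k, 0 < k → k < ℓ → Bk k ≤ (Bk (k - 1)).map μ := by
    intro k hk hkℓ
    have hjac : maximalIdeal A ≤ (⊥ : Ideal A).jacobson := by
      rw [IsLocalRing.jacobson_eq_maximalIdeal ⊥ bot_ne_top]
    refine Submodule.le_of_le_smul_of_le_jacobson_bot (hBkfg k) hjac ?_
    intro b hb
    have hbm : b ∈ maximalIdeal B := hBkm k hk hkℓ b hb
    obtain ⟨c, rfl⟩ := (hmemBk k b).mp hb
    -- `ℓ · P_k c = P_k (P_k c)` and `P_k c ∈ 𝔪_B = (z₀, z_j)`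
    rw [← hspan, Ideal.mem_span_insert] at hbm
    obtain ⟨c₀, r, hr, hbeq⟩ := hbm
    obtain ⟨cs, hcs⟩ := (Ideal.mem_span_range_iff_exists_fun).mp hr
    -- write `P_k c` as `ℓ⁻¹ · P_k (P_k c)`
    obtain ⟨v, hv⟩ := (hℓu' ▸ ℓu.isUnit : IsUnit (ℓ : A))
    have hkey : P k c = (↑v⁻¹ : A) • P k (P k c) := by
      rw [hPP, Algebra.smul_def, ← mul_assoc, show (ℓ : B) = φ (ℓ : A) from (map_natCast φ ℓ).symm,
        ← map_mul, ← hv, Units.inv_mul, map_one, one_mul]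
    rw [hkey]
    refine Submodule.smul_mem _ _ ?_
    rw [hbeq, hPadd, ← hcs, mul_comm c₀ z₀, hPz k _ hk]
    refine Submodule.add_mem _ (Submodule.mem_sup_left ⟨P (k - 1) c₀, (hmemBk _ _).mpr ⟨c₀, rfl⟩, rfl⟩)
      (Submodule.mem_sup_right ?_)
    -- `P_k (∑ cs_j · z_j) = ∑ z_j · P_k cs_j ∈ 𝔪_A • B_k`
    have hsum : P k (∑ j, cs j * φ (z j)) = ∑ j, z j • P k (cs j) := by
      rw [show P k (∑ j, cs j * φ (z j)) = Pl k (∑ j, cs j * φ (z j)) from rfl, map_sum]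
      refine Finset.sum_congr rfl fun j _ => ?_
      rw [hPl, mul_comm, hPA, Algebra.smul_def]
    rw [hsum]
    exact Submodule.sum_mem _ fun j _ =>
      Submodule.smul_mem_smul (hzm j) ((hmemBk _ _).mpr ⟨cs j, rfl⟩)
  -- (S3) `B_k ⊆ z₀^k B_0` for `k < ℓ`
  have hpow : ∀ k, k < ℓ → ∀ b ∈ Bk k, ∃ c ∈ Bk 0, b = z₀ ^ k * c := by
    intro k
    induction k with
    | zero => intro _ b hb; exact ⟨b, hb, by rw [pow_zero, one_mul]⟩
    | succ k ih =>
      intro hkℓ b hb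
      have h1 := hstep (k + 1) (Nat.succ_pos k) hkℓ hb
      rw [Nat.add_sub_cancel] at h1
      obtain ⟨b', hb', rfl⟩ := Submodule.mem_map.mp h1
      obtain ⟨c, hc, rfl⟩ := ih (Nat.lt_of_succ_lt hkℓ) b' hb'
      exact ⟨c, hc, by rw [hμ, pow_succ]; ring⟩
  -- (S4) `B_0 ⊆ A`
  have hB0 : ∀ b ∈ Bk 0, ∃ a : A, φ a = b := by
    intro b hb
    obtain ⟨c, rfl⟩ := (hmemBk 0 b).mp hb
    obtain ⟨a, ha⟩ := hfix (P 0 c) (by rw [hσP, pow_zero, map_one, one_mul])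
    exact ⟨a, ha⟩
  /- the invariant `w₀ = z₀^ℓ` and the maximal ideal of `A` -/
  obtain ⟨w₀, hw₀⟩ : ∃ w₀ : A, φ w₀ = z₀ ^ ℓ := by
    obtain ⟨a, ha⟩ := hfix (z₀ ^ ℓ) (by
      rw [map_pow, hz₀, mul_pow, ← map_pow, hζℓ, map_one, one_mul])
    exact ⟨a, ha⟩
  have hmA : Ideal.span (insert w₀ (Set.range z)) = maximalIdeal A := by
    apply le_antisymm
    · rw [Ideal.span_le]
      rintro a (rfl | ⟨j, rfl⟩)
      · rw [SetLike.mem_coe, hmemA, hw₀]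
        exact Ideal.pow_mem_of_mem _ hz₀m _ hℓpos
      · exact hzm j
    · intro a ha
      have haB : φ a ∈ maximalIdeal B := (hmemA a).mp ha
      rw [← hspan, Ideal.mem_span_insert] at haB
      obtain ⟨c₀, r, hr, haeq⟩ := haB
      obtain ⟨cs, hcs⟩ := (Ideal.mem_span_range_iff_exists_fun).mp hr
      -- apply `P_0`: `ℓ φ(a) = z₀ P_{ℓ−1}(c₀) + ∑ z_j P_0(cs_j)`
      have h1 : P 0 (φ a) = φ ((ℓ : A) * a) := by rw [hPφ, hchar0]
      have h2 : P 0 (φ a) = z₀ * P (ℓ - 1) c₀ + ∑ j, φ (z j) * P 0 (cs j) := by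
        rw [haeq, hPadd, ← hcs, mul_comm c₀ z₀, hPz',
          show P 0 (∑ j, cs j * φ (z j)) = Pl 0 (∑ j, cs j * φ (z j)) from rfl, map_sum]
        congr 1
        refine Finset.sum_congr rfl fun j _ => ?_
        rw [hPl, mul_comm, hPA]
      -- `P_{ℓ−1}(c₀) = z₀^{ℓ−1} φ(a')`, `P_0(cs_j) = φ(a_j)`
      obtain ⟨c', hc', hc'eq⟩ := hpow (ℓ - 1) (Nat.sub_lt hℓpos Nat.one_pos) _
        ((hmemBk _ _).mpr ⟨c₀, rfl⟩)
      obtain ⟨a', rfl⟩ := hB0 c' hc'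
      have hPj : ∀ j, ∃ aj : A, φ aj = P 0 (cs j) := fun j => hB0 _ ((hmemBk _ _).mpr ⟨cs j, rfl⟩)
      choose aj haj using hPj
      have h3 : φ ((ℓ : A) * a) = φ (w₀ * a' + ∑ j, z j * aj j) := by
        rw [← h1, h2, hc'eq, map_add, map_mul, hw₀, map_sum]
        congr 1
        · rw [← mul_assoc, ← pow_succ', Nat.sub_add_cancel hℓpos]
        · exact Finset.sum_congr rfl fun j _ => by rw [map_mul, haj]
      have h4 : (ℓ : A) * a = w₀ * a' + ∑ j, z j * aj j := hinj h3
      obtain ⟨v, hv⟩ := (hℓu' ▸ ℓu.isUnit : IsUnit (ℓ : A))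
      have h5 : a = (↑v⁻¹ : A) * (w₀ * a' + ∑ j, z j * aj j) := by
        rw [← h4, ← mul_assoc, ← hv, Units.inv_mul, one_mul]
      rw [h5]
      refine Ideal.mul_mem_left _ _ (Ideal.add_mem _ ?_ ?_)
      · exact Ideal.mul_mem_right _ _ (Ideal.subset_span (Set.mem_insert _ _))
      · exact Ideal.sum_mem _ fun j _ =>
          Ideal.mul_mem_right _ _ (Ideal.subset_span (Set.mem_insert_of_mem _ ⟨j, rfl⟩))
  /- regularity of `A` -/
  refine ⟨?_, w₀, hw₀, hmA⟩
  apply IsRegularLocalRing.of_spanFinrank_maximalIdeal_le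
  have hdimA : ringKrullDim A = (d + 1 : ℕ) := by
    rw [Literature.RingTheory.KrullDimension.ringKrullDim_eq_of_isIntegral hinj, hdim]
  rw [hdimA, ← hmA]
  have h1 : (Ideal.span (insert w₀ (Set.range z))).spanFinrank ≤ d + 1 := by
    refine (Submodule.spanFinrank_span_le_ncard_of_finite
      ((Set.finite_range z).insert w₀)).trans ?_
    refine (Set.ncard_insert_le _ _).trans ?_
    have h2 : (Set.range z).ncard ≤ d := by
      calc (Set.range z).ncard ≤ (Finset.univ.image z).card := by
            rw [← Set.ncard_coe_finset, Finset.coe_image, Finset.coe_univ, Set.image_univ]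
        _ ≤ d := Finset.card_image_le.trans (by simp)
    omega
  exact_mod_cast h1

end Invariants

end Literature.AlgebraicGeometry.Resolution

end
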